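import Summits.ResolutionOfSingularities.ResolutionOfSingularities.Theses.CleanCovers
import Summits.ResolutionOfSingularities.ResolutionOfSingularities.Theorems.CleanCoversCoverResolutionKedlayaLocalCover
import Summits.ResolutionOfSingularities.ResolutionOfSingularities.Theorems.CleanCoversCoverResolutionCoverInductionOverField
import Summits.ResolutionOfSingularities.ResolutionOfSingularities.Theorems.CleanCoversCoverResolutionBinaryPatchingOverField
import Summits.ResolutionOfSingularities.ResolutionOfSingularities.Theorems.UniversalCellsLocalToGlobalCoverPatchingOfTrdegLe
import Summits.ResolutionOfSingularities.ResolutionOfSingularities.Theorems.CleanCoversCoverResolutionGradedConverses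
import Summits.ResolutionOfSingularities.ResolutionOfSingularities.Theorems.CleanCoversCoverResolutionLowDimension
import Summits.ResolutionOfSingularities.ResolutionOfSingularities.Theorems.UniversalCellsLocalToGlobalDimensionSlices
import Literature.AlgebraicGeometry.Motives.VarietiesProperProofs
import Mathlib.Topology.KrullDimension
import HarnessLib

/-!
# Crux `CleanCovers.CoverResolution` (stmt-ResolutionOfSingularities-15104), line `strategy-split`
# v2.1: the DIMENSION-GRADED no-slack cycle `CR(≤ d) ↔ L(≤ d) ∧ T(trdeg ≤ d)` and the first open case `d = 4`

Route `ResolutionOfSingularities/CleanCovers`, line lead (continuation seat c1)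
`prover-line-stmt-ResolutionOfSingularities-15104-c1-0`, 2026-08-17. The landed equivalence
`coverResolution_iff_boundaryLocalResolution_and_twoModelPatchingPerfect` (crux ↔ local resolution
along the hyperplane at infinity ∧ Zariski two-model patching over perfect fields) is GRADED BY
DIMENSION here. Write `CR(≤ d)` for the crux restricted to covers of `ℙⁿ_k` with `n ≤ d`, `L(≤ d)`
for its local piece so restricted, and `T(trdeg ≤ d)` for two-model patching of proper models of
function fields of transcendence degree `≤ d` over perfect fields of characteristic `p` (all
written VERBATIM as binders; no `def`s).

* `coverResolution_dimLe_of_boundaryLocalResolution_dimLe_of_twoModelPatchingPerfect_trdegLe`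
  (**L(≤ d) → T(trdeg ≤ d) → CR(≤ d)**, graded assembly): as the v2 assembly, but binary patching
  of resolvable opens of the `n`-dimensional cover `X` (`dim X = n`, finite surjective over `ℙⁿ_k`,
  `topologicalKrullDim_eq_of_kedlayaCover`) and of its open subschemes (`dim ≤ n ≤ d` along open
  immersions) needs two-model patching only in transcendence degree `≤ d`
  (`binaryPatchingOverField_of_trdegLe`, `Theorems/CleanCoversCoverResolutionGradedPatching.lean`, from
  `stub_coverPatching_of_trdegLe`; re-proved here as the private twin `binaryPatching_trdegLe_aux`
  so that this file does not depend on that module's build order on the farm).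
* `coverResolution_dimLe_iff` (**CR(≤ d) ↔ L(≤ d) ∧ T(trdeg ≤ d)** for every `d`): with the graded
  converses `boundaryLocalResolution_dimLe_of_coverResolution_dimLe` (restriction) and
  `twoModelPatchingPerfect_trdegLe_of_coverResolution_dimLe` (graded Kedlaya reduction
  `resolutionOverUpToDim_of_coverResolution_dimLe` + resolving joins).
* `coverResolution_iff_forall_dimLe` (**CR ↔ ∀ d, CR(≤ d)**), bookkeeping.
* `coverResolution_dimLe_four_iff_of_cossartPiltant2019` (**the first open case, modulo
  Cossart–Piltant 2019**): `CR(≤ 4) ↔ L(n = 4) ∧ T(trdeg = 4)` — resolution of Kedlaya covers of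
  `ℙⁿ`, `n ≤ 4`, over perfect fields is EXACTLY local resolution along the hyperplane at infinity
  for covers of `ℙ⁴` together with Zariski's two-model patching for function fields of
  transcendence degree `4` over perfect fields (the sibling cruxes' atom
  `stub_twoModelPatching_primeField_trdeg_four` at all perfect fields), granted the dimension-`≤ 3`
  theorem of Cossart–Piltant (`CossartPiltant2019`, a named fact taken as a hypothesis; the
  `≤ 3` slices are `boundaryLocalResolution_dim_le_three_of_cossartPiltant2019` and
  `twoModelPatchingPerfect_trdeg_le_three_of_cossartPiltant2019`).
-/

-- single-problem summit: the doubled namespace component `ResolutionOfSingularities` is forced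
set_option linter.dupNamespace false

noncomputable section

namespace Summit.ResolutionOfSingularities.ResolutionOfSingularities.Theorems

open CategoryTheory AlgebraicGeometry TopologicalSpace
open Literature.AlgebraicGeometry.Resolution
open Summit.ResolutionOfSingularities.ResolutionOfSingularities.Theses.CleanCovers

/-! ## Graded binary patching (private twin of `binaryPatchingOverField_of_trdegLe`) -/

/-- Private twin of `binaryPatchingOverField_of_trdegLe` (landed separately): with two-model
patching of proper models of function fields of transcendence degree `≤ n` over `k` and
`dim X ≤ n`, two resolvable opens `U ∪ V = X` of an integral separated finite-type `k`-scheme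
patch to a resolution (Nagata extension of both local resolutions,
`exists_integral_partialResolution_of_hasResolution_opens`, then
`stub_coverPatching_of_trdegLe`). [folklore] -/
private theorem binaryPatching_trdegLe_aux (k : Type) [Field k] (n : ℕ)
    (hT : ∀ (K : Type) [Field K] [Algebra k K] [Algebra.EssFiniteType k K],
      Algebra.trdeg k K ≤ n → ∀ (M₁ M₂ : ProperModel k K),
        ∃ (N : ProperModel k K) (φ₁ : N.Hom M₁) (φ₂ : N.Hom M₂), φ₁.RegLe ∧ φ₂.RegLe)
    (X : Scheme.{0}) (g : X ⟶ Spec (.of k)) [IsSeparated g] [LocallyOfFiniteType g]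
    [QuasiCompact g] [IsIntegral X] (hX : topologicalKrullDim X ≤ n) (U V : X.Opens)
    (hUV : U ⊔ V = ⊤) (hU : Scheme.HasResolution (U : Scheme.{0}))
    (hV : Scheme.HasResolution (V : Scheme.{0})) : Scheme.HasResolution X := by
  obtain ⟨Z₁, π₁, hZ₁, hπ₁, hb₁, hr₁⟩ :=
    exists_integral_partialResolution_of_hasResolution_opens k X g U hU
  obtain ⟨Z₂, π₂, hZ₂, hπ₂, hb₂, hr₂⟩ :=
    exists_integral_partialResolution_of_hasResolution_opens k X g V hV
  haveI := hZ₁; haveI := hπ₁; haveI := hZ₂; haveI := hπ₂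
  exact stub_coverPatching_of_trdegLe k n hT X g hX U V hUV π₁ π₂ hb₁ hb₂ hr₁ hr₂

/-! ## Graded assembly -/

/-- **L(≤ d) → T(trdeg ≤ d) → CR(≤ d)** (graded assembly of line `strategy-split`): for a Kedlaya
cover `f : X → ℙⁿ_k` with `n ≤ d`, `dim X = n`; every point has a resolvable open neighbourhood
(`stub_kedlayaLocalCover` with L); two resolvable opens of an integral open subscheme `W`
(`dim W ≤ n ≤ d`) patch by two-model patching in transcendence degree `≤ d`
(`binaryPatchingOverField_of_trdegLe`); induct over a finite subcover
(`stub_coverInductionOverField`). [folklore] -/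
theorem coverResolution_dimLe_of_boundaryLocalResolution_dimLe_of_twoModelPatchingPerfect_trdegLe : ∀ d : ℕ, (∀ p : ℕ, p.Prime → ∀ (k : Type) [Field k] [CharP k p] [PerfectField k] (n : ℕ) (X : AlgebraicGeometry.Scheme.{0}) (f : X ⟶ (Literature.AlgebraicGeometry.Motives.projectiveSpace n k).left), AlgebraicGeometry.IsIntegral X → AlgebraicGeometry.IsFinite f → Function.Surjective f.base → (letI := MvPolynomial.gradedAlgebra (σ := Fin (n + 1)) (R := k); AlgebraicGeometry.Etale (f ∣_ (AlgebraicGeometry.Proj.basicOpen (MvPolynomial.homogeneousSubmodule (Fin (n + 1)) k) (MvPolynomial.X (Fin.last n))))) → n ≤ d → ∀ h : (Literature.AlgebraicGeometry.Motives.projectiveSpace n k).left, (letI := MvPolynomial.gradedAlgebra (σ := Fin (n + 1)) (R := k); h ∉ AlgebraicGeometry.Proj.basicOpen (MvPolynomial.homogeneousSubmodule (Fin (n + 1)) k) (MvPolynomial.X (Fin.last n))) → ∃ B : (Literature.AlgebraicGeometry.Motives.projectiveSpace n k).left.Opens, h ∈ B ∧ Literature.AlgebraicGeometry.Resolution.Scheme.HasResolution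 ((f ⁻¹ᵁ B : X.Opens) : AlgebraicGeometry.Scheme.{0})) → (∀ p : ℕ, p.Prime → ∀ (k : Type) [Field k] [CharP k p] [PerfectField k] (K : Type) [Field K] [Algebra k K] [Algebra.EssFiniteType k K], Algebra.trdeg k K ≤ d → ∀ (M₁ M₂ : Literature.AlgebraicGeometry.Resolution.ProperModel k K), ∃ (N : Literature.AlgebraicGeometry.Resolution.ProperModel k K) (φ₁ : N.Hom M₁) (φ₂ : N.Hom M₂), φ₁.RegLe ∧ φ₂.RegLe) → (∀ p : ℕ, p.Prime → ∀ (k : Type) [Field k] [CharP k p] [PerfectField k] (n : ℕ) (X : AlgebraicGeometry.Scheme.{0}) (f : X ⟶ (Literature.AlgebraicGeometry.Motives.projectiveSpace n k).left), AlgebraicGeometry.IsIntegral X → AlgebraicGeometry.IsFinite f → Function.Surjective f.base → (letI := MvPolynomial.gradedAlgebra (σ := Fin (n + 1)) (R := k); AlgebraicGeometry.Etale (f ∣_ (AlgebraicGeometry.Proj.basicOpen (MvPolynomial.homogeneousSubmodule (Fin (n + 1)) k) (MvPolynomial.X (Fin.last n))))) → n ≤ d → Literature.AlgebraicGeometry.Resolution.Scheme.HasResolution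 X) := by
  intro d hL hT p hp k _ _ _ n X f hint hfin hsurj het hn
  haveI := hfin
  haveI := hint
  haveI : IsProper (Literature.AlgebraicGeometry.Motives.projectiveSpace n k).hom :=
    Literature.AlgebraicGeometry.Motives.isProper_projectiveSpace n k
  -- the `k`-structure of `X`
  let g : X ⟶ Spec (.of k) := f ≫ (Literature.AlgebraicGeometry.Motives.projectiveSpace n k).hom
  haveI : IsSeparated g := inferInstance
  haveI : LocallyOfFiniteType g := inferInstance
  haveI : QuasiCompact g := inferInstance
  haveI : IsLocallyNoetherian X := LocallyOfFiniteType.isLocallyNoetherian g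
  haveI : CompactSpace X := QuasiCompact.compactSpace_of_compactSpace g
  -- `dim X = n ≤ d`
  have hdimX : topologicalKrullDim X = n := topologicalKrullDim_eq_of_kedlayaCover k n X f hsurj
  have hdimXd : topologicalKrullDim X ≤ d := by
    rw [hdimX]
    exact_mod_cast hn
  refine stub_coverInductionOverField X inferInstance hint
    (stub_kedlayaLocalCover k n X f het (hL p hp k n X f hint hfin hsurj het hn)) ?_
  intro W hW U V hUV hU hV
  haveI := hW
  have hdimW : topologicalKrullDim (W : Scheme.{0}) ≤ d :=
    W.ι.isOpenEmbedding.isInducing.topologicalKrullDim_le.trans hdimXd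
  exact binaryPatching_trdegLe_aux k d (hT p hp k) W (W.ι ≫ g) hdimW U V hUV hU hV

/-! ## The graded no-slack cycle -/

/-- **CR(≤ d) ↔ L(≤ d) ∧ T(trdeg ≤ d)** for every `d`: the crux in dimension `≤ d` is equivalent
to the conjunction of its local piece in dimension `≤ d` and Zariski's two-model patching over
perfect fields in transcendence degree `≤ d`. [folklore] -/
theorem coverResolution_dimLe_iff : ∀ d : ℕ, (∀ p : ℕ, p.Prime → ∀ (k : Type) [Field k] [CharP k p] [PerfectField k] (n : ℕ) (X : AlgebraicGeometry.Scheme.{0}) (f : X ⟶ (Literature.AlgebraicGeometry.Motives.projectiveSpace n k).left), AlgebraicGeometry.IsIntegral X → AlgebraicGeometry.IsFinite f → Function.Surjective f.base → (letI := MvPolynomial.gradedAlgebra (σ := Fin (n + 1)) (R := k); AlgebraicGeometry.Etale (f ∣_ (AlgebraicGeometry.Proj.basicOpen (MvPolynomial.homogeneousSubmodule (Fin (n + 1)) k) (MvPolynomial.X (Fin.last n))))) → n ≤ d → Literature.AlgebraicGeometry.Resolution.Scheme.HasResolution X) ↔ ((∀ p : ℕ, p.Prime → ∀ (k : Type) [Field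 k] [CharP k p] [PerfectField k] (n : ℕ) (X : AlgebraicGeometry.Scheme.{0}) (f : X ⟶ (Literature.AlgebraicGeometry.Motives.projectiveSpace n k).left), AlgebraicGeometry.IsIntegral X → AlgebraicGeometry.IsFinite f → Function.Surjective f.base → (letI := MvPolynomial.gradedAlgebra (σ := Fin (n + 1)) (R := k); AlgebraicGeometry.Etale (f ∣_ (AlgebraicGeometry.Proj.basicOpen (MvPolynomial.homogeneousSubmodule (Fin (n + 1)) k) (MvPolynomial.X (Fin.last n))))) → n ≤ d → ∀ h : (Literature.AlgebraicGeometry.Motives.projectiveSpace n k).left, (letI := MvPolynomial.gradedAlgebra (σ := Fin (n + 1)) (R := k); h ∉ AlgebraicGeometry.Proj.basicOpen (MvPolynomial.homogeneousSubmodule (Fin (n + 1)) k) (MvPolynomial.X (Fin.last n))) → ∃ B : (Literature.AlgebraicGeometry.Motives.projectiveSpace n k).left.Opens, h ∈ B ∧ Literature.AlgebraicGeometry.Resolution.Scheme.HasResolution ((f ⁻¹ᵁ B : X.Opens) : AlgebraicGeometry.Scheme.{0})) ∧ (∀ p : ℕ, p.Prime → ∀ (k : Type) [Field k] [CharP k p]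 [PerfectField k] (K : Type) [Field K] [Algebra k K] [Algebra.EssFiniteType k K], Algebra.trdeg k K ≤ d → ∀ (M₁ M₂ : Literature.AlgebraicGeometry.Resolution.ProperModel k K), ∃ (N : Literature.AlgebraicGeometry.Resolution.ProperModel k K) (φ₁ : N.Hom M₁) (φ₂ : N.Hom M₂), φ₁.RegLe ∧ φ₂.RegLe)) :=
  fun d => ⟨fun h => ⟨boundaryLocalResolution_dimLe_of_coverResolution_dimLe d h,
      twoModelPatchingPerfect_trdegLe_of_coverResolution_dimLe d h⟩,
    fun h => coverResolution_dimLe_of_boundaryLocalResolution_dimLe_of_twoModelPatchingPerfect_trdegLe d h.1 h.2⟩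

/-- **CR ↔ ∀ d, CR(≤ d)** (bookkeeping). [folklore] -/
theorem coverResolution_iff_forall_dimLe : Summit.ResolutionOfSingularities.ResolutionOfSingularities.Theses.CleanCovers.CoverResolution ↔ ∀ d : ℕ, (∀ p : ℕ, p.Prime → ∀ (k : Type) [Field k] [CharP k p] [PerfectField k] (n : ℕ) (X : AlgebraicGeometry.Scheme.{0}) (f : X ⟶ (Literature.AlgebraicGeometry.Motives.projectiveSpace n k).left), AlgebraicGeometry.IsIntegral X → AlgebraicGeometry.IsFinite f → Function.Surjective f.base → (letI := MvPolynomial.gradedAlgebra (σ := Fin (n + 1)) (R := k); AlgebraicGeometry.Etale (f ∣_ (AlgebraicGeometry.Proj.basicOpen (MvPolynomial.homogeneousSubmodule (Fin (n + 1)) k) (MvPolynomial.X (Fin.last n))))) → n ≤ d → Literature.AlgebraicGeometry.Resolution.Scheme.HasResolution X) :=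
  ⟨fun hC _ p hp k _ _ _ n X f hint hfin hsurj het _ => hC p hp k n X f hint hfin hsurj het,
    fun h p hp k _ _ _ n X f hint hfin hsurj het => h n p hp k n X f hint hfin hsurj het le_rfl⟩

/-! ## The first open case: `d = 4`, modulo Cossart–Piltant 2019 -/

/-- **`CR(≤ 4) ↔ L(n = 4) ∧ T(trdeg = 4)`, modulo `CossartPiltant2019`**: granted resolution in
dimension `≤ 3` (Cossart–Piltant 2019, named fact, hypothesis), resolution of Kedlaya covers of
`ℙⁿ` over perfect fields for all `n ≤ 4` is equivalent to the conjunction of (i) local resolution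
along the hyperplane at infinity for Kedlaya covers of `ℙ⁴` and (ii) Zariski's two-model patching
of proper models of function fields of transcendence degree exactly `4` over perfect fields — the
`≤ 3` slices of both being theorems modulo `CossartPiltant2019`
(`boundaryLocalResolution_dim_le_three_of_cossartPiltant2019`,
`twoModelPatchingPerfect_trdeg_le_three_of_cossartPiltant2019`).
[cite: CossartPiltant2019, Thm. 1.1; Piltant2013, p. 2] -/
theorem coverResolution_dimLe_four_iff_of_cossartPiltant2019 : Literature.AlgebraicGeometry.Resolution.CossartPiltant2019.{0} → ((∀ p : ℕ, p.Prime → ∀ (k : Type) [Field k] [CharP k p] [PerfectField k] (n : ℕ) (X : AlgebraicGeometry.Scheme.{0}) (f : X ⟶ (Literature.AlgebraicGeometry.Motives.projectiveSpace n k).left), AlgebraicGeometry.IsIntegral X → AlgebraicGeometry.IsFinite f → Function.Surjective f.base → (letI := MvPolynomial.gradedAlgebra (σ := Fin (n + 1)) (R := k); AlgebraicGeometry.Etale (f ∣_ (AlgebraicGeometry.Proj.basicOpen (MvPolynomial.homogeneousSubmodule (Fin (n + 1)) k) (MvPolynomial.X (Fin.last n))))) → n ≤ 4 → Literature.AlgebraicGeometry.Resolution.Scheme.HasResolution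 X) ↔ ((∀ p : ℕ, p.Prime → ∀ (k : Type) [Field k] [CharP k p] [PerfectField k] (n : ℕ) (X : AlgebraicGeometry.Scheme.{0}) (f : X ⟶ (Literature.AlgebraicGeometry.Motives.projectiveSpace n k).left), AlgebraicGeometry.IsIntegral X → AlgebraicGeometry.IsFinite f → Function.Surjective f.base → (letI := MvPolynomial.gradedAlgebra (σ := Fin (n + 1)) (R := k); AlgebraicGeometry.Etale (f ∣_ (AlgebraicGeometry.Proj.basicOpen (MvPolynomial.homogeneousSubmodule (Fin (n + 1)) k) (MvPolynomial.X (Fin.last n))))) → n = 4 → ∀ h : (Literature.AlgebraicGeometry.Motives.projectiveSpace n k).left, (letI := MvPolynomial.gradedAlgebra (σ := Fin (n + 1)) (R := k); h ∉ AlgebraicGeometry.Proj.basicOpen (MvPolynomial.homogeneousSubmodule (Fin (n + 1)) k) (MvPolynomial.X (Fin.last n))) → ∃ B : (Literature.AlgebraicGeometry.Motives.projectiveSpace n k).left.Opens, h ∈ B ∧ Literature.AlgebraicGeometry.Resolution.Scheme.HasResolution ((f ⁻¹ᵁ B : X.Opens) : AlgebraicGeometry.Scheme.{0})) ∧ (∀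 p : ℕ, p.Prime → ∀ (k : Type) [Field k] [CharP k p] [PerfectField k] (K : Type) [Field K] [Algebra k K] [Algebra.EssFiniteType k K], Algebra.trdeg k K = 4 → ∀ (M₁ M₂ : Literature.AlgebraicGeometry.Resolution.ProperModel k K), ∃ (N : Literature.AlgebraicGeometry.Resolution.ProperModel k K) (φ₁ : N.Hom M₁) (φ₂ : N.Hom M₂), φ₁.RegLe ∧ φ₂.RegLe))) := by
  intro hCP
  constructor
  · intro hC
    refine ⟨fun p hp k _ _ _ n X f hint hfin hsurj het hn h hh => ?_,
      fun p hp k _ _ _ K _ _ _ hK M₁ M₂ => ?_⟩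
    · exact boundaryLocalResolution_dimLe_of_coverResolution_dimLe 4 hC p hp k n X f hint hfin
        hsurj het hn.le h hh
    · exact twoModelPatchingPerfect_trdegLe_of_coverResolution_dimLe 4 hC p hp k K hK.le M₁ M₂
  · rintro ⟨hL4, hT4⟩
    refine coverResolution_dimLe_of_boundaryLocalResolution_dimLe_of_twoModelPatchingPerfect_trdegLe
      4 ?_ ?_
    · intro p hp k _ _ _ n X f hint hfin hsurj het hn h hh
      by_cases h4 : n = 4
      · exact hL4 p hp k n X f hint hfin hsurj het h4 h hh
      · exact boundaryLocalResolution_dim_le_three_of_cossartPiltant2019 hCP p hp k n X f hint hfin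
          hsurj het (by omega) h hh
    · intro p hp k _ _ _ K _ _ _ hK M₁ M₂
      by_cases h3 : Algebra.trdeg k K ≤ 3
      · exact twoModelPatchingPerfect_trdeg_le_three_of_cossartPiltant2019 hCP p hp k K h3 M₁ M₂
      · exact hT4 p hp k K (trdeg_eq_four_of_le_four_of_not_le_three hK h3) M₁ M₂

end Summit.ResolutionOfSingularities.ResolutionOfSingularities.Theorems

end
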